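import Mathlib
import Summits.KontsevichZagierPeriods.Zeta5Search.LaiBrickCoefficients
import Summits.KontsevichZagierPeriods.Zeta5Search.LaiGrowthBricks
import HarnessLib

/-!
# ζ(5) search — growth side of Lai's box function, part 2: the divided derivatives of `laiG` at a pole
# (fam-indep, κ₃ ladder: the `growth` / `β` input, step 2)

HONEST FRAMING: systematic search; no irrationality claim unless certified.

OUR work (Summit side; cell `pub-zeta5`, family `indep`, planner seat gen 4, STAGED for the lane). With the brick
calculus of `LaiGrowthBricks.lean` (`IsDBnd`, closed under products) and the brick form of Lai's regularised summand
`laiG_k(t) = (2t+Mn) ∏_{q<r} polyBrick(−rn+qn, n) ∏_{q<r} polyBrick(Mn+1+qn, n) ∏_j recipBrickReg(δ_j n, (M−2δ_j)n+1, k)`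
(`LaiBricks.lean`), every divided derivative of `laiG_k` at `t = −k` (`0 ≤ k ≤ Mn`) is bounded by
**`laiGAbs(k) · laiGWidth^i`** (`laiG_isDBnd`, `abs_divDeriv_laiG_le`), where
* `laiGAbs(k) = (|Mn − 2k| + 2) · ∏_q |polyBrick(−rn+qn,n)(−k)| · ∏_q |polyBrick(Mn+1+qn,n)(−k)| · ∏_j recipRegAbs(δ_j n, (M−2δ_j)n+1, k)`
  is the CENTRE SIZE (a ratio of factorials: `(k+rn)!/k! · ((M+r)n−k)!/(Mn−k)! / n!^{2r}` times block binomials — evaluated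
  in part 3), and
* `laiGWidth = 1 + 2rn + Σ_j ((M−2δ_j)n + 2) ≤ 1 + 2rn + J(Mn+2)` (`laiGWidth_le`) is POLYNOMIAL in `n`.
Combined with `divDeriv_laiG_eq` (`LaiBrickCoefficients.lean`: `𝒟_{J−s} laiG_k(−k) = C_n c_{s−1,k}`) this gives the
coefficient bound **`|C_n · c_{s−1,k}| ≤ laiGAbs(k) · laiGWidth^{J−s}`** (`abs_laiC_mul_pf_le`) for ANY partial-fraction
data `c` — Lai's Lemma 5.4 ([Lai2024BallRivoal, (5.14)–(5.16)]) with the Cauchy circle `|z+k| = 1/10` replaced by the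
Leibniz rule, hence with no loss `10^{J}` and no complex analysis. The `growth` field of the skeleton `LaiBoxInputs`
(rate `β̃ = (2r+M) log((2r+M)/2) − M log(M/2) + log 2 · Σ_j (M − 2δ_j)`) then only needs the factorial asymptotics of
`max_k laiGAbs(k)` (part 3, successor work).

References: [Lai2024BallRivoal, §5 Lemma 5.4, §13]; [Zudilin2004, §7].
-/

open Finset Filter Literature.NumberTheory.Transcendental Literature.Analysis.Calculus
open scoped Nat Topology

namespace Summit.KontsevichZagierPeriods.Zeta5Search

noncomputable section

/-! ### Centre size and width -/

/-- The centre size of `laiG_k` at `−k`: `(|Mn−2k| + 2) ∏_q |polyBrick(−rn+qn,n)(−k)| ∏_q |polyBrick(Mn+1+qn,n)(−k)|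
∏_j recipRegAbs(δ_j n, (M−2δ_j)n+1, k)`. [this file] -/
def laiGAbs (J r M n : ℕ) (δ : Fin J → ℕ) (k : ℕ) : ℚ :=
  (|2 * (-(k : ℚ)) + (M : ℚ) * n| + 2) * (∏ q ∈ range r, |polyBrick (-((r * n : ℕ) : ℤ) + ((q * n : ℕ) : ℤ)) n (-(k : ℚ))|) *
    (∏ q ∈ range r, |polyBrick (((M * n + 1 + q * n : ℕ) : ℤ)) n (-(k : ℚ))|) *
    ∏ j, recipRegAbs (((δ j * n : ℕ) : ℤ)) ((M - 2 * δ j) * n + 1) (k : ℤ)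

/-- The width of `laiG`: `1 + rn + rn + Σ_j ((M−2δ_j)n + 1 + 1)` (one unit per linear factor or simple pole, in the
association produced by `IsDBnd.mul`). [this file] -/
def laiGWidth (J r M n : ℕ) (δ : Fin J → ℕ) : ℚ :=
  1 + (∑ _q ∈ range r, (n : ℚ)) + (∑ _q ∈ range r, (n : ℚ)) + ∑ j : Fin J, ((((M - 2 * δ j) * n + 1 : ℕ) : ℚ) + 1)

/-- `0 ≤ laiGAbs`. [folklore] -/
theorem laiGAbs_nonneg (J r M n : ℕ) (δ : Fin J → ℕ) (k : ℕ) : 0 ≤ laiGAbs J r M n δ k :=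
  mul_nonneg (mul_nonneg (mul_nonneg (by positivity) (prod_nonneg fun _ _ => abs_nonneg _))
    (prod_nonneg fun _ _ => abs_nonneg _)) (prod_nonneg fun _ _ => recipRegAbs_nonneg _ _ _)

/-- `1 ≤ laiGWidth`. [folklore] -/
theorem one_le_laiGWidth (J r M n : ℕ) (δ : Fin J → ℕ) : 1 ≤ laiGWidth J r M n δ := by
  have h1 : 0 ≤ ∑ _q ∈ range r, (n : ℚ) := sum_nonneg fun _ _ => Nat.cast_nonneg _
  have h2 : 0 ≤ ∑ j : Fin J, ((((M - 2 * δ j) * n + 1 : ℕ) : ℚ) + 1) := sum_nonneg fun _ _ => by positivity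
  rw [laiGWidth]; linarith

/-- `laiGWidth ≤ 1 + 2rn + J(Mn + 2)` — polynomial in `n`. [this file] -/
theorem laiGWidth_le (J r M n : ℕ) (δ : Fin J → ℕ) :
    laiGWidth J r M n δ ≤ ((1 + 2 * r * n + J * (M * n + 2) : ℕ) : ℚ) := by
  have h : ∀ j ∈ (univ : Finset (Fin J)), ((((M - 2 * δ j) * n + 1 : ℕ) : ℚ) + 1) ≤ ((M * n + 2 : ℕ) : ℚ) := by
    intro j _
    have : (M - 2 * δ j) * n ≤ M * n := Nat.mul_le_mul_right _ (Nat.sub_le _ _)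
    have : ((((M - 2 * δ j) * n + 1 : ℕ) : ℚ)) ≤ ((M * n + 1 : ℕ) : ℚ) := by exact_mod_cast Nat.add_le_add_right this 1
    push_cast at this ⊢; linarith
  have hs := sum_le_sum h
  rw [sum_const, card_univ, Fintype.card_fin, nsmul_eq_mul] at hs
  rw [laiGWidth, sum_const, card_range, nsmul_eq_mul]
  push_cast at hs ⊢
  linarith

/-! ### The bound -/

/-- **`laiG_k` has bounded divided derivatives at `−k`** with constants `(laiGAbs(k), laiGWidth)`, for `0 ≤ k ≤ Mn`.
[this file] -/
theorem laiG_isDBnd (J r M n : ℕ) (δ : Fin J → ℕ) {k : ℕ} (hk : k ≤ M * n) (N : ℕ) :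
    IsDBnd N (laiG J r M n δ k) (-(k : ℚ)) (laiGAbs J r M n δ k) (laiGWidth J r M n δ) := by
  have hlin := IsDBnd.affine N 2 ((M : ℚ) * n) (-(k : ℚ))
  have h1 : ∀ q ∈ range r, IsDBnd N (polyBrick (-((r * n : ℕ) : ℤ) + ((q * n : ℕ) : ℤ)) n) (-(k : ℚ))
      |polyBrick (-((r * n : ℕ) : ℤ) + ((q * n : ℕ) : ℤ)) n (-(k : ℚ))| n := by
    intro q hq
    refine polyBrick_isDBnd N _ n (k : ℤ) fun l hl => ?_
    have hq' : q + 1 ≤ r := mem_range.1 hq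
    have hqn : q * n + n ≤ r * n := by
      have := Nat.mul_le_mul_right n hq'
      rwa [Nat.add_mul, one_mul] at this
    omega
  have h2 : ∀ q ∈ range r, IsDBnd N (polyBrick (((M * n + 1 + q * n : ℕ) : ℤ)) n) (-(k : ℚ))
      |polyBrick (((M * n + 1 + q * n : ℕ) : ℤ)) n (-(k : ℚ))| n := by
    intro q _
    refine polyBrick_isDBnd N _ n (k : ℤ) fun l _ => ?_
    omega
  have h3 : ∀ j ∈ (univ : Finset (Fin J)),
      IsDBnd N (recipBrickReg (((δ j * n : ℕ) : ℤ)) ((M - 2 * δ j) * n + 1) (k : ℤ)) (-(k : ℚ))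
        (recipRegAbs (((δ j * n : ℕ) : ℤ)) ((M - 2 * δ j) * n + 1) (k : ℤ)) ((((M - 2 * δ j) * n + 1 : ℕ) : ℚ) + 1) := by
    intro j _
    have h := recipBrickReg_isDBnd N (((δ j * n : ℕ) : ℤ)) ((M - 2 * δ j) * n + 1) (k : ℤ)
    have hpt : ((k : ℤ) : ℚ) = (k : ℚ) := Int.cast_natCast k
    rw [hpt] at h
    exact h
  have hall := ((hlin.mul (IsDBnd.prod (range r) h1)).mul (IsDBnd.prod (range r) h2)).mul (IsDBnd.prod univ h3)
  refine (hall.congr (Eventually.of_forall fun t => rfl)).of_eq ?_ rfl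
  rw [laiGAbs, abs_two]

/-- **Bound on the divided derivatives of `laiG_k` at `−k`**: `|𝒟ᵢ laiG_k(−k)| ≤ laiGAbs(k) · laiGWidth^i`. [this file] -/
theorem abs_divDeriv_laiG_le (J r M n : ℕ) (δ : Fin J → ℕ) {k : ℕ} (hk : k ≤ M * n) (i : ℕ) :
    |divDeriv i (laiG J r M n δ k) (-(k : ℚ))| ≤ laiGAbs J r M n δ k * laiGWidth J r M n δ ^ i :=
  (laiG_isDBnd J r M n δ hk i).bound i le_rfl

/-- **Lai's Lemma 5.4, Leibniz form**: for ANY partial-fraction data `c` of `laiPoly(t+1)/(t+1)_{Mn+1}^J` (as in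
`divDeriv_laiG_eq`), `|C_n · c_{s−1,k}| ≤ laiGAbs(k) · laiGWidth^{J−s}` for `1 ≤ s ≤ J`, `0 ≤ k ≤ Mn`.
[cite: Lai2024BallRivoal, Lemma 5.4] (our proof: Leibniz rule instead of Cauchy's estimate) -/
theorem abs_laiC_mul_pf_le (J r M n : ℕ) (δ : Fin J → ℕ) (hδ : ∀ j, 2 * δ j ≤ M) (hM : 0 < M)
    {c : ℕ → ℕ → ℚ}
    (hc : ∀ t : ℚ, (∀ p : ℕ, p ≤ M * n → t + p + 1 ≠ 0) →
      BallRivoal.pfEval (M * n) J c t =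
        ((laiPoly J r M n δ).comp (Polynomial.X + Polynomial.C 1)).eval t / BallRivoal.poch (t + 1) (M * n + 1) ^ J)
    {k : ℕ} (hk : k ≤ M * n) {s : ℕ} (hs₁ : 1 ≤ s) (hsJ : s ≤ J) :
    |laiC J r M n δ * c (s - 1) k| ≤ laiGAbs J r M n δ k * laiGWidth J r M n δ ^ (J - s) := by
  have h := divDeriv_laiG_eq J r M n δ hδ hM hc hk (a := J - s) (by omega)
  rw [show J - 1 - (J - s) = s - 1 by omega] at h
  rw [← h]
  exact abs_divDeriv_laiG_le J r M n δ hk (J - s)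

end

end Summit.KontsevichZagierPeriods.Zeta5Search
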